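/-
Copyright (c) 2026 the pub-hodgecm-mathlib formalisation cell (harness21).  Prover seat hodgecm-mathlib-B-p14 (g37), 2026-09-01.  Road «S3-tree» (architect A-p16 (g30) A-128∕A-145∕A-152),
brick T3′ «depth-zero κ-transfer», population (P-2) TYPE (2), row (R2²) «THE FREE ROW», head [T2-d] sub-organ (D2-γ-CM) (R2² holder A-p19 (g26) «go» 20:25:16Z; statement-first by the
CONSUMER, sha16 cac82a8db0418f40, re-tokened: two idle binders dropped): A SELF-DUAL `τ`-CYCLIC LATTICE EXISTS IFF `ord_E d₀ + n` IS EVEN.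
-/
import Literature.NumberTheory.Automorphic.RationalCyclicSelfDualLattices      -- ★ seam p846609
import Literature.NumberTheory.Automorphic.RationalGoodVectorParity            -- ★ core p846562
import Literature.NumberTheory.Automorphic.SymmetricEigenframeExists           -- ★ frame p846649
import Literature.NumberTheory.Automorphic.ValuedFieldValuativeRelBridge       -- ★ `v_eq_iff_valuation_eq`, `v_le_one_iff_mem_integer`, …
import Literature.NumberTheory.Automorphic.SplitTorusOrderStratumParity        -- ★ `exists_poly_eval_mul_eq_one`
import HarnessLib


/-!
# Self-dual cyclic lattices of a type-(2) unitary element: the parity criterion (Rogawski 1990 Lemma 4.9.3; Jacobowitz 1962 §7)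

Topic `NumberTheory/Automorphic`; namespace `Literature.NumberTheory.Automorphic.SymmetricEigenframe`.  ONE THEOREM (no definition, no instance, no notation, no named fact, no
`sorry`): the one-place composite of ★ `exists_symmetric_eigenframe` (frame, p846649) ∘ ★ `exists_selfDual_cyclic_iff_exists_rational_good` (seam, p846609) ∘
★ `exists_rational_good_iff_even` (core, p846562), with the parity inputs `hd0 hodd` of the core supplied by ★ `odd_half_log_add_log_of_symmetric_frame` ∘ `odd_log_of_map_eq_neg` ∘
`map_det_eq_neg_det_of_cols` (kernel, p846537).  Generic one-place currency: two valued fields `E` (the CM place `L_w`, involution `σ = σ_w`) and `K` (the ramified eigen-field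
`K₁ = L_w(√disc)`, involutions `σ_K` over `σ` and `ι` over `id`, uniformiser-type element `θ` with `ιθ = −θ`, `|θ| = q_K^{-1}`) joined by `j : E →+* K` with `|j x|_K = |x|_E²`; every
hypothesis is ONE token held by the consumer (★ (D1) `hJ hJh hτU hχ hσu hu1 hx₀ hx₀0`; ★ (D2-β) `exists_eigenField_package` p846663: `hs'ι hs's' hs'v hι'ι hι'θ hι'ι' hι'v hcomm hθv
hcoord hquad hlamO hlam1 hnorm1 hne hexpn hexpN hrE hnK hnE` with `toPlace v w ↦ j`, `s' ↦ σK`, `ι' ↦ ι`).  Cell `pub/hodgecm-mathlib` (D-0151), crux H413 = `stmt-HodgeConjecture-24833`;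
road «S3-tree», brick T3′, P-2 row (R2²) (holder A-p19 (g26), consumed by ONE `have` in (D4)).  HONEST LABEL: HC_CM is proved only modulo the 2 remaining named inputs (hLiu418 24832,
h413 24833) until rung 0 closes; composition of ★ material, asserts nothing printed.

THE MATHEMATICS.  `χ_τ = (X − u)(X² − tX + D)`, `λ ∈ K` a root of the quadratic factor with `λ·σ_Kλ = 1`, `ιλ ≠ λ`, `|ju − λ| = q^{-n}`, `|λ − ιλ| = q^{-(2N+1)}`: the eigenvalues
`γ = (ju, λ, ιλ)` are pairwise distinct integral of norm one with `|1 + γ_i| = 1` (`|u − 1|, |λ − 1| < 1`, `|2| = 1`); the frame gives `τ^K = P·diag(γ)·P⁻¹`, `Gram(P) = diag(j d₀, d₁, ι d₁)`;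
`ι(det P) = −det P` so `log|det P|` is odd (`θ`), `|det J| = 1`, hence `log|j d₀|` is even and `½ log|j d₀| + log|d₁|` is odd; `Fix ι = j(E)` from the coordinates `z = jp + jq·θ`
(`2θ ≠ 0`); the seam turns «some `L(w) = span_𝒪{τ^k w}` is `Λ(g)`, `g ∈ U(σ,J)`» into «a rational GOOD vector exists», the core turns that into «`½ log|j d₀|_K + n` even», and
`½ log|j d₀|_K = log|d₀|_E`.

* **`exists_selfDual_cyclic_iff_even_log`**.

## References
* [Rogawski1990] J. D. Rogawski, *Automorphic Representations of Unitary Groups in Three Variables* (1990), §4.9 Lemma 4.9.3 p. 56, Prop. 4.9.1 (b) p. 55.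
* [Jacobowitz1962] R. Jacobowitz, *Hermitian forms over local fields*, Amer. J. Math. 84 (1962), §5, §7 Thm. 7.1.
* [Kottwitz1986] R. E. Kottwitz, *Base change for unit elements of Hecke algebras*, Compositio Math. 60 (1986), §3.
-/

set_option autoImplicit false

noncomputable section

open Finset Matrix Polynomial
open scoped MatrixGroups ValuativeRel WithZero
open ValuativeRel

namespace Literature.NumberTheory.Automorphic.SymmetricEigenframe

open Literature.NumberTheory.Automorphic Literature.NumberTheory.Automorphic.UnitaryGroup

/-- **(D2-γ-CM) «A SELF-DUAL `τ`-CYCLIC LATTICE EXISTS IFF `ord_E d₀ + n` IS EVEN»** — one-place composite of ★ `exists_symmetric_eigenframe` (frame), ★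
`exists_selfDual_cyclic_iff_exists_rational_good` (seam) and ★ `exists_rational_good_iff_even` (core) for a type-(2) unitary `τ` (`χ_τ = (X − u)(X² − tX + D)`) over the CM place
`E` with its ramified eigen-field `j : E → K = E(√disc)` (involutions `σ_K` over `σ`, `ι` over `id`, `ι θ = −θ`), the eigenvalue `λ ∈ K` and the rational `u`-eigenvector `x₀`:
«some `L(w) = span_𝒪{τ^k w}` equals some `Λ(g) = span_𝒪 (gᵀ)`, `g ∈ U(σ,J)`» iff `log|d₀|_E + n` is even, `d₀ = ᵗσ(x₀)·J·x₀`.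
[cite: Rogawski1990, §4.9 Lemma 4.9.3 p. 56, Prop. 4.9.1 (b) p. 55] [cite: Jacobowitz1962, §5, §7 Thm. 7.1] [cite: Kottwitz1986, §3] -/
theorem exists_selfDual_cyclic_iff_even_log
    {E K : Type*} [Field E] [Valued E ℤᵐ⁰] [ValuativeRel E] [(Valued.v : Valuation E ℤᵐ⁰).Compatible]
    [Field K] [Valued K ℤᵐ⁰] [ValuativeRel K] [(Valued.v : Valuation K ℤᵐ⁰).Compatible]
    -- the CM place `E = L_w`: `σ = σ_w` (★ `galAdicCompletionMap_galAdicCompletionMap_of_smul_eq`, ★ `mem_integer_galAdicCompletionMap`, `htr` from `|2| = 1`,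
    -- ★ `UnramifiedQuadraticNorm.exists_mul_map_eq_of_isUnit_integer`, ★ (D2-α) `exists_skew_unit`, `|2|_w = 1`)
    (σ : E →+* E) (hσσ : ∀ x, σ (σ x) = x) (hσO : ∀ x : 𝒪[E], σ x ∈ 𝒪[E]) (htr : ∃ b : 𝒪[E], (b : E) + σ b = 1)
    (hnorm : ∀ u : 𝒪[E], IsUnit u → σ u = u → ∃ t : 𝒪[E], (t : E) * σ t = u)
    {δE : E} (hσδE : σ δE = -δE) (hδEv : Valued.v δE = 1)
    (h2 : Valued.v (2 : E) = 1)
    -- the hyperspecial hermitian form and the type-(2) unitary `τ` with its one-place data (★ (D1) A-p12 (g22): `hJ hJh hτU hχ hσu hu1 hx₀ hx₀0`)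
    (J : GL (Fin 3) E) (hJ : J ∈ glInt 3 E) (hJh : ((J : Matrix (Fin 3) (Fin 3) E).map σ)ᵀ = J)
    (τ : Matrix (Fin 3) (Fin 3) E) (hτU : (τ.map σ)ᵀ * (J : Matrix (Fin 3) (Fin 3) E) * τ = J)
    {u t D : E} (hχ : τ.charpoly = (X - C u) * (X ^ 2 - C t * X + C D))
    (hσu : σ u * u = 1) (hu1 : Valued.v (u - 1) < 1)
    {x₀ : Fin 3 → E} (hx₀ : τ *ᵥ x₀ = u • x₀) (hx₀0 : x₀ ≠ 0)
    -- the ramified eigen-field `j = ι₁ : E → K` (★ `valued_toPlace_of_ramificationIdx'_eq_two`) and the (D2-β) package VERBATIM (★ p846663 `exists_eigenField_package`: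
    -- `hs'ι hs'θ hs's' hs'v`, `hι'ι hι'θ hι'ι' hι'v hcomm`, `hθv hcoord`, `hquad hlamO hlam1 hnorm1 hne hexpn hexpN`, `hrE hnK hnE`)
    (j : E →+* K) (hjv : ∀ x, Valued.v (j x) = Valued.v x ^ 2)
    (σK ι : K →+* K) (hσj : ∀ x, σK (j x) = j (σ x)) (hσKσK : ∀ y, σK (σK y) = y) (hσKv : ∀ y, Valued.v (σK y) = Valued.v y)
    (hιj : ∀ x, ι (j x) = j x) (hιι : ∀ y, ι (ι y) = y) (hιv : ∀ y, Valued.v (ι y) = Valued.v y) (hσKι : ∀ y, σK (ι y) = ι (σK y))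
    {θ : K} (hθv : Valued.v θ = WithZero.exp (-1 : ℤ)) (hιθ : ι θ = -θ)
    (hcoord : ∀ z : K, ∃! pq : E × E, z = j pq.1 + j pq.2 * θ)
    {lam : K} (hquad : lam ^ 2 - j t * lam + j D = 0) (hlamO : lam ∈ 𝒪[K]) (hlam1 : Valued.v (lam - 1) < 1) (hσlam : lam * σK lam = 1) (hne : ι lam ≠ lam)
    {n N : ℕ} (hexpn : Valued.v (j u - lam) = WithZero.exp (-(n : ℤ))) (hexpN : Valued.v (lam - ι lam) = WithZero.exp (-((2 * N + 1 : ℕ) : ℤ)))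
    (hrE : ∀ x : K, x ≠ 0 → ι x = x → Even (WithZero.log (Valued.v x)))
    (hnK : ∀ c : K, c ≠ 0 → σK c = c → Even (WithZero.log (Valued.v c)) → ∃ a : K, a * σK a * c = 1)
    (hnE : ∀ c : K, c ≠ 0 → σK c = c → ι c = c → (4 : ℤ) ∣ WithZero.log (Valued.v c) → ∃ a : K, ι a = a ∧ a * σK a * c = 1) :
    (∃ w : Fin 3 → E, ∃ g ∈ unitaryGroupOfForm σ (J : Matrix (Fin 3) (Fin 3) E),
      Submodule.span 𝒪[E] (Set.range fun k : Fin 3 => (τ ^ (k : ℕ)) *ᵥ w) = Submodule.span 𝒪[E] (Set.range ((g : Matrix (Fin 3) (Fin 3) E))ᵀ)) ↔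
    Even (WithZero.log (Valued.v (∑ k, ∑ i, σ (x₀ i) * (J : Matrix (Fin 3) (Fin 3) E) i k * x₀ k)) + n) := by
  classical
  /- §0 valuation bookkeeping across the bridge `Valued.v ↔ valuation` -/
  have hO : ∀ x ∈ 𝒪[K], Valued.v x ≤ 1 := fun x hx => (v_le_one_iff_mem_integer x).2 hx
  have hjO : ∀ x : E, j x ∈ 𝒪[K] ↔ x ∈ 𝒪[E] := fun x => by
    rw [← v_le_one_iff_mem_integer, ← v_le_one_iff_mem_integer, hjv, pow_le_one_iff two_ne_zero]
  have hσKv' : ∀ y, valuation K (σK y) = valuation K y := fun y => (v_eq_iff_valuation_eq _ _).1 (hσKv y)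
  have h2K : Valued.v (2 : K) = 1 := by rw [← map_ofNat j 2, hjv, h2, one_pow]
  have h2K0 : (2 : K) ≠ 0 := fun h => by rw [h, map_zero] at h2K; exact zero_ne_one h2K
  have hθ0 : θ ≠ 0 := fun h => by rw [h, map_zero] at hθv; exact WithZero.exp_ne_zero hθv.symm
  /- §1 `Fix ι = j(E)` from the coordinates `z = j p + j q·θ` -/
  have hιj' : ∀ y, ι y = y ↔ ∃ x, j x = y := by
    intro y
    refine ⟨fun hy => ?_, ?_⟩
    · obtain ⟨⟨p, q⟩, hpq, -⟩ := hcoord y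
      have h := hy
      rw [hpq, map_add, map_mul, hιj, hιj, hιθ] at h
      have h2q : (2 : K) * (j q * θ) = 0 := by linear_combination -h
      have hq0 : j q = 0 := (mul_eq_zero.1 ((mul_eq_zero.1 h2q).resolve_left h2K0)).resolve_right hθ0
      exact ⟨p, by rw [hpq, hq0, zero_mul, add_zero]⟩
    · rintro ⟨x, rfl⟩
      exact hιj x
  /- §2 the eigenvalues `γ = (j u, λ, ι λ)`: non-zero, norm one, integral, `|1 + γ_i| = 1`, pairwise distinct -/
  have hσu' : σ u = u⁻¹ := eq_inv_of_mul_eq_one_left hσu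
  have hu0 : u ≠ 0 := fun h => by rw [h, mul_zero] at hσu; exact zero_ne_one hσu
  have hlam0 : lam ≠ 0 := fun h => by rw [h, zero_mul] at hσlam; exact zero_ne_one hσlam
  have hσlam' : σK lam = lam⁻¹ := eq_inv_of_mul_eq_one_right hσlam
  have hvu : Valued.v u = 1 := by
    have h := Valuation.map_one_add_of_lt (Valued.v : Valuation E ℤᵐ⁰) hu1
    rwa [add_sub_cancel] at h
  have hvE1u : Valued.v (1 + u) = 1 := by
    have hlt : Valued.v (u - 1) < Valued.v (2 : E) := by rw [h2]; exact hu1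
    have h := Valuation.map_add_eq_of_lt_left (Valued.v : Valuation E ℤᵐ⁰) hlt
    rw [h2] at h
    rwa [show (1 : E) + u = 2 + (u - 1) by ring]
  have hv1ju : Valued.v (1 + j u) = 1 := by rw [← map_one j, ← map_add, hjv, hvE1u, one_pow]
  have hv1lam : Valued.v (1 + lam) = 1 := by
    have hlt : Valued.v (lam - 1) < Valued.v (2 : K) := by rw [h2K]; exact hlam1
    have h := Valuation.map_add_eq_of_lt_left (Valued.v : Valuation K ℤᵐ⁰) hlt
    rw [h2K] at h
    rwa [show (1 : K) + lam = 2 + (lam - 1) by ring]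
  have hv1ιlam : Valued.v (1 + ι lam) = 1 := by rw [← map_one ι, ← map_add, hιv, hv1lam]
  have hγO : ∀ i, (![j u, lam, ι lam] : Fin 3 → K) i ∈ 𝒪[K] := by
    intro i
    fin_cases i
    · exact (hjO u).2 ((v_le_one_iff_mem_integer u).1 hvu.le)
    · exact hlamO
    · show ι lam ∈ 𝒪[K]
      exact (v_le_one_iff_mem_integer _).1 (by rw [hιv]; exact hO _ hlamO)
  have hσγ : ∀ i, σK ((![j u, lam, ι lam] : Fin 3 → K) i) = ((![j u, lam, ι lam] : Fin 3 → K) i)⁻¹ := by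
    intro i
    fin_cases i
    · show σK (j u) = (j u)⁻¹
      rw [hσj, hσu', map_inv₀]
    · exact hσlam'
    · show σK (ι lam) = (ι lam)⁻¹
      rw [hσKι, hσlam', map_inv₀]
  have hγne : ∀ i, (![j u, lam, ι lam] : Fin 3 → K) i ≠ 0 := by
    intro i
    fin_cases i
    · exact (map_ne_zero j).2 hu0
    · exact hlam0
    · exact (map_ne_zero ι).2 hlam0
  have hγu : ∀ i, ∃ y ∈ 𝒪[K], y * (![j u, lam, ι lam] : Fin 3 → K) i = 1 := fun i =>
    ⟨σK _, (v_le_one_iff_mem_integer _).1 (by rw [hσKv]; exact hO _ (hγO i)), by rw [hσγ, inv_mul_cancel₀ (hγne i)]⟩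
  obtain ⟨r, hr⟩ := exists_poly_eval_mul_eq_one 𝒪[K] hγO hγu
  have hγ1 : ∀ i, Valued.v (1 + (![j u, lam, ι lam] : Fin 3 → K) i) = 1 := by
    intro i
    fin_cases i
    · exact hv1ju
    · exact hv1lam
    · exact hv1ιlam
  have hγ1u : ∀ i, ∃ y ∈ 𝒪[K], y * (1 + (![j u, lam, ι lam] : Fin 3 → K) i) = 1 := fun i => by
    have hne0 : (1 + (![j u, lam, ι lam] : Fin 3 → K) i) ≠ 0 := fun h => by
      have h1 := hγ1 i
      rw [h, map_zero] at h1
      exact zero_ne_one h1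
    exact ⟨(1 + (![j u, lam, ι lam] : Fin 3 → K) i)⁻¹, (v_le_one_iff_mem_integer _).1 (by rw [map_inv₀, hγ1 i, inv_one]), inv_mul_cancel₀ hne0⟩
  have h01 : j u ≠ lam := fun h => by
    rw [h, sub_self, map_zero] at hexpn
    exact WithZero.exp_ne_zero hexpn.symm
  have h12 : lam ≠ ι lam := fun h => hne h.symm
  have h02 : j u ≠ ι lam := fun h => h01 (by rw [← hιj u, h, hιι])
  have hinj : Function.Injective (![j u, lam, ι lam] : Fin 3 → K) := by
    intro a b hab
    fin_cases a <;> fin_cases b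
    all_goals
      first
      | rfl
      | exact absurd hab h01
      | exact absurd hab.symm h01
      | exact absurd hab h02
      | exact absurd hab.symm h02
      | exact absurd hab h12
      | exact absurd hab.symm h12
  have hιγ0 : ι ((![j u, lam, ι lam] : Fin 3 → K) 0) = (![j u, lam, ι lam] : Fin 3 → K) 0 := hιj u
  have hιγ1 : ι ((![j u, lam, ι lam] : Fin 3 → K) 1) = (![j u, lam, ι lam] : Fin 3 → K) 2 := rfl
  have hιγ2 : ι ((![j u, lam, ι lam] : Fin 3 → K) 2) = (![j u, lam, ι lam] : Fin 3 → K) 1 := hιι lam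
  have h01' : WithZero.log (Valued.v ((![j u, lam, ι lam] : Fin 3 → K) 0 - (![j u, lam, ι lam] : Fin 3 → K) 1)) = -(n : ℤ) := by
    show WithZero.log (Valued.v (j u - lam)) = _
    rw [hexpn, WithZero.log_exp]
  have h12' : WithZero.log (Valued.v ((![j u, lam, ι lam] : Fin 3 → K) 1 - (![j u, lam, ι lam] : Fin 3 → K) 2)) = -((2 * N + 1 : ℕ) : ℤ) := by
    show WithZero.log (Valued.v (lam - ι lam)) = _
    rw [hexpN, WithZero.log_exp]
  /- §3 the symmetric eigenframe (★ frame) -/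
  have hJdet : (J : Matrix (Fin 3) (Fin 3) E).det ≠ 0 := (Matrix.isUnits_det_units J).ne_zero
  have hlam : ((τ.map j).charpoly).IsRoot lam := by
    rw [Matrix.charpoly_map, hχ, Polynomial.map_mul, Polynomial.root_mul]
    refine Or.inr ?_
    simp only [Polynomial.map_add, Polynomial.map_sub, Polynomial.map_mul, Polynomial.map_pow, Polynomial.map_X, Polynomial.map_C,
      Polynomial.IsRoot.def, Polynomial.eval_add, Polynomial.eval_sub, Polynomial.eval_mul, Polynomial.eval_pow, Polynomial.eval_X,
      Polynomial.eval_C]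
    exact hquad
  obtain ⟨P, d₁, hτ, -, hP0, hP1, hP2, hGram, hd₁σ, hd₁0, hd₀0⟩ :=
    exists_symmetric_eigenframe j σ σK ι hσj hιj hσKι hιι hσKσK (J : Matrix (Fin 3) (Fin 3) E) hJh hJdet τ hτU hx₀ hx₀0 hlam
      (by rw [mul_comm]; exact hσlam) hσu h01 h02 h12
  set d₀ : E := ∑ k, ∑ i, σ (x₀ i) * (J : Matrix (Fin 3) (Fin 3) E) i k * x₀ k with hd₀
  /- §4 the Gram values `d = (j d₀, d₁, ι d₁)` and the skew unit `δ = j δE` -/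
  have hJki : ∀ i k, σ ((J : Matrix (Fin 3) (Fin 3) E) i k) = (J : Matrix (Fin 3) (Fin 3) E) k i := fun i k => by
    have h := congrFun (congrFun hJh k) i
    rwa [Matrix.transpose_apply, Matrix.map_apply] at h
  have hσd₀ : σ d₀ = d₀ := by
    rw [hd₀, map_sum]
    simp_rw [map_sum, map_mul, hσσ, hJki]
    rw [Finset.sum_comm]
    refine Finset.sum_congr rfl fun a _ => Finset.sum_congr rfl fun b _ => ?_
    ring
  have hjd₀0 : j d₀ ≠ 0 := (map_ne_zero j).2 hd₀0
  have hdσ : ∀ i, σK ((![j d₀, d₁, ι d₁] : Fin 3 → K) i) = (![j d₀, d₁, ι d₁] : Fin 3 → K) i := by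
    intro i
    fin_cases i
    · show σK (j d₀) = j d₀
      rw [hσj, hσd₀]
    · exact hd₁σ
    · show σK (ι d₁) = ι d₁
      rw [hσKι, hd₁σ]
  have hdne : ∀ i, (![j d₀, d₁, ι d₁] : Fin 3 → K) i ≠ 0 := by
    intro i
    fin_cases i
    · exact hjd₀0
    · exact hd₁0
    · exact (map_ne_zero ι).2 hd₁0
  have hιd0 : ι ((![j d₀, d₁, ι d₁] : Fin 3 → K) 0) = (![j d₀, d₁, ι d₁] : Fin 3 → K) 0 := hιj d₀
  have hιd1 : ι ((![j d₀, d₁, ι d₁] : Fin 3 → K) 1) = (![j d₀, d₁, ι d₁] : Fin 3 → K) 2 := rfl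
  have hδv : Valued.v (j δE) = 1 := by rw [hjv, hδEv, one_pow]
  have hδ0 : j δE ≠ 0 := fun h => by rw [h, map_zero] at hδv; exact zero_ne_one hδv
  have hδO : j δE ∈ 𝒪[K] := (v_le_one_iff_mem_integer _).1 hδv.le
  have hδu : ∃ y ∈ 𝒪[K], y * j δE = 1 :=
    ⟨(j δE)⁻¹, (v_le_one_iff_mem_integer _).1 (by rw [map_inv₀, hδv, inv_one]), inv_mul_cancel₀ hδ0⟩
  have hσδ : σK (j δE) = -j δE := by rw [hσj, hσδE, map_neg]
  have hιδ : ι (j δE) = j δE := hιj δE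
  /- §5 the parity of the frame (★ kernel): `log|j d₀|` even, `½ log|j d₀| + log|d₁|` odd -/
  have hθodd : Odd (WithZero.log (Valued.v θ)) := by
    rw [hθv, WithZero.log_exp]
    exact ⟨-1, by norm_num⟩
  have hdetP : Odd (WithZero.log (Valued.v (P : Matrix (Fin 3) (Fin 3) K).det)) :=
    odd_log_of_map_eq_neg ι hrE hθ0 hιθ hθodd (Matrix.isUnits_det_units P).ne_zero (map_det_eq_neg_det_of_cols ι _ hP0 hP1 hP2)
  have hJK : Valued.v ((J : Matrix (Fin 3) (Fin 3) E).map j).det = 1 := by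
    rw [← RingHom.mapMatrix_apply, ← RingHom.map_det, hjv, (v_eq_one_iff_valuation_eq_one _).2 (valuation_det_eq_one_of_mem_glInt hJ), one_pow]
  obtain ⟨hd0, hodd⟩ := odd_half_log_add_log_of_symmetric_frame σK hσKv (((J : Matrix (Fin 3) (Fin 3) E)).map j) (P : Matrix (Fin 3) (Fin 3) K)
    ![j d₀, d₁, ι d₁] hGram hjd₀0 hd₁0 (by show Valued.v (ι d₁) = Valued.v d₁; exact hιv d₁) hJK hdetP
  /- §6 seam ∘ core, then `½ log|j d₀|_K = log|d₀|_E` -/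
  refine (exists_selfDual_cyclic_iff_exists_rational_good σ hσσ hσO htr hnorm J hJ hJh τ j hjO σK hσj hσKv' ι hιι hιj' P hτ hGram hP0 hP1 hP2
    hγO hinj hσγ hr).trans ?_
  refine (exists_rational_good_iff_even 𝒪[K] hO σK ι hσKι hσKv hιv hnK hnE hrE hγO hγ1u hγ1 hσγ hγne hinj hιγ0 hιγ1 hιγ2 hdσ hdne hιd0 hιd1
    hδO hδu hδv hσδ hιδ h01' h12' hd0 hodd).trans ?_
  have hlog : WithZero.log (Valued.v ((![j d₀, d₁, ι d₁] : Fin 3 → K) 0)) / 2 = WithZero.log (Valued.v d₀) := by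
    show WithZero.log (Valued.v (j d₀)) / 2 = _
    rw [hjv, WithZero.log_pow, nsmul_eq_mul, Nat.cast_ofNat, Int.mul_ediv_cancel_left _ two_ne_zero]
  rw [hlog]

end Literature.NumberTheory.Automorphic.SymmetricEigenframe

end
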